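import Literature.IUT.LogVolume.DyadicDiffTwoIsometryStable
import Literature.IUT.LogVolume.WildGaussianIsometryMover
import HarnessLib

/-!
# The pure-tensor criterion is SHARP in `p`: at `p = 2` the packet `ℚ₂(√−1) ⊗ ℚ₂(√−1)` is fixed by every factorwise
# isometry, yet its maximal order is NOT generated by pure tensors

Classical local algebra (nothing disputed; the [IUTchIV] locator records where the abc-iut cell uses it).  Sequel of
`IsometryStablePureTensorCriterion` (abc-iut-E-t9): there, for `p` ODD, the maximal `ℤ_p`-order `(R_I)^∼` of a tensor
packet ([IUTchIV] Prop. 1.1 p. 9; `normalizedPacket`) is fixed by every tuple of factorwise `ℚ_p`-linear isometries iff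
`(PG)` `(R_I)^∼` is additively generated by its integral pure tensors; the proof of «fixed ⟹ (PG)» used `‖2‖_p = 1`.  THIS
FILE shows that the hypothesis `p ≠ 2` cannot be dropped.  Let `K` be an ultrametric normed field over `ℚ₂` with
`[K : ℚ₂] = 2` and `i ∈ K`, `i² = −1` (up to isomorphism `K = ℚ₂(√−1)`: wild, `e = 2`, `f = 1`, different `(2)` — the residual
dyadic class).  By abc-iut-E-cx-2's `DyadicDiffTwoIsometryStable` every pair of factorwise `ℚ₂`-linear isometries FIXES
`(R_I)^∼ ⊆ K ⊗_{ℚ₂} K`; by `WildGaussianIsometryMover` the Gauss idempotent `x = ½(1 ⊗ 1 − i ⊗ i)` lies in `(R_I)^∼`.  We prove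

* §1 (any `p`, any `K`, two slots) `exists_pairFunctional` — for a `ℚ_p`-linear `ℓ : K → ℚ_p` the functional
  `Φ_ℓ : K ⊗ K → K`, `a ⊗ b ↦ ℓ(b)·a` (Mathlib `PiTensorProduct.lift` of `mkPiAlgebra ∘ (id, ℓ)`);
  `norm_mul_norm_le_one_of_purePacket_mem` — an INTEGRAL pure tensor `a ⊗ b ∈ (R_I)^∼` has `‖a‖·‖b‖ ≤ 1` (one field-factor
  coordinate, campaign-S `dEquiv`);
* §2 `exists_functional_one_pi` — at `K ∋ π`, `π² = c`, `‖c‖ = 1`, `‖1 + c‖ ≤ ¼`, `[K : ℚ₂] = 2`: the functional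
  `ℓ = (coefficient of 1) + (coefficient of π)` in the basis `(1, π)` has `ℓ(1) = ℓ(π) = 1` and `‖ℓ(b)‖ ≤ ‖b‖`
  (E-cx-2's `DyadicDiffTwo.norm_combo`: `‖s + tπ‖ = max(‖s + t‖, ‖t‖·‖1 − π‖)`);
* §3 **`gaussIdempotent_not_mem_closure_pure`** — `x ∉ AddSubgroup.closure {integral pure tensors}`: `Φ_ℓ` has norm `≤ 1`
  on every integral pure tensor (`‖ℓ(b)‖·‖a‖ ≤ ‖a‖‖b‖ ≤ 1`), hence on their additive span (ultrametric), while
  `Φ_ℓ(x) = ½(1 − i)` has norm `2·‖1 − i‖ = √2 > 1`;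
* §4 **`isometry_stable_and_not_closure_pure`**, **`not_closure_pure_of_isometry_stable_two`** — at such `K` BOTH «every
  factorwise isometry pair fixes `(R_I)^∼`» AND «`¬(PG)`» hold: the `p`-odd dividing line
  `PureTensorCriterion.isometry_stable_iff_closure_pure` FAILS at `p = 2`; **`exists_gaussianDyadic_stable_not_closure_pure`**
  — NON-VACUITY inside `ℚ̄₂` (`K = ℚ₂(√−1) ⊆ ℚ̄₂`).

Use (abc-iut cell, R-J row Y-29b, mixed-packet / dyadic wording): CONTAINERS only; no side taken on [IUTchIII] Cor. 3.12.
PROOF-ONLY file (theorems, no definitions, no `Prop` facts, no `sorry`).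
[cite: Mochizuki2012, IUTchIV Prop. 1.1 p. 9] [cite: NeukirchANT1999, Ch. II (4.8)] [cite: SerreLocalFields1979, Ch. II §1]
-/

noncomputable section

open Module Function Set Metric

namespace Literature.IUT.LogVolume
namespace PureTensorCriterion

/-! ## §1 Two-slot packets over any `p`: the functional `a ⊗ b ↦ ℓ(b)·a`; integral pure tensors have `‖a‖‖b‖ ≤ 1` -/

section TwoSlots

variable {p : ℕ} [Fact p.Prime] {K : Type} [NontriviallyNormedField K] [NormedAlgebra ℚ_[p] K]

/-- **The functional `Φ_ℓ : a ⊗ b ↦ ℓ(b)·a`** on `K ⊗_{ℚ_p} K`, for any `ℚ_p`-linear `ℓ : K → ℚ_p`: the lift of the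
multilinear map `(a, b) ↦ a·ℓ(b)` (Mathlib `MultilinearMap.mkPiAlgebra` composed with `(id, ℓ)` slotwise).
[cite: Mochizuki2012, IUTchIV Prop. 1.1 p. 9] -/
theorem exists_pairFunctional (ℓ : K →ₗ[ℚ_[p]] ℚ_[p]) :
    ∃ Φ : PacketAlgebra p (fun _ : Fin 2 => K) →ₗ[ℚ_[p]] K,
      ∀ y : Fin 2 → K, Φ (purePacket p (fun _ : Fin 2 => K) y) = ℓ (y 1) • y 0 := by
  let f : Fin 2 → (K →ₗ[ℚ_[p]] K) := ![LinearMap.id, Algebra.linearMap ℚ_[p] K ∘ₗ ℓ]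
  let m : MultilinearMap ℚ_[p] (fun _ : Fin 2 => K) K :=
    (MultilinearMap.mkPiAlgebra ℚ_[p] (Fin 2) K).compLinearMap f
  refine ⟨PiTensorProduct.lift m, fun y => ?_⟩
  change PiTensorProduct.lift m (PiTensorProduct.tprod ℚ_[p] y) = _
  rw [PiTensorProduct.lift.tprod, MultilinearMap.compLinearMap_apply, MultilinearMap.mkPiAlgebra_apply,
    Fin.prod_univ_two]
  simp only [f, Matrix.cons_val_zero, Matrix.cons_val_one, LinearMap.id_apply,
    LinearMap.comp_apply, Algebra.linearMap_apply]
  rw [Algebra.smul_def, mul_comm]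

/-- **An integral pure tensor `a ⊗ b ∈ (R_I)^∼` has `‖a‖·‖b‖ ≤ 1`**: its coordinate in any field factor `L_j` of
`K ⊗ K ≅ Π_j L_j` is `ι⁰_j(a)·ι¹_j(b)`, of norm `‖a‖·‖b‖`, and `(R_I)^∼` maps into `Π_j 𝒪_{L_j}`.
[cite: Mochizuki2012, IUTchIV Prop. 1.1 p. 9] -/
theorem norm_mul_norm_le_one_of_purePacket_mem [IsUltrametricDist K] [ProperSpace K] {y : Fin 2 → K}
    (hy : purePacket p (fun _ : Fin 2 => K) y ∈ normalizedPacket p (fun _ : Fin 2 => K)) : ‖y 0‖ * ‖y 1‖ ≤ 1 := by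
  obtain ⟨j⟩ := (inferInstance : Nonempty (DIdx p (fun _ : Fin 2 => K)))
  have hy' : y = ![y 0, y 1] := by funext s; fin_cases s <;> rfl
  have h := norm_dEquiv_le_one_of_mem_normalizedPacket p (fun _ : Fin 2 => K) hy j
  rwa [hy', TameQuadratic.dEquiv_purePacket_pair, norm_mul, norm_dEquiv_iota, norm_dEquiv_iota] at h

end TwoSlots

/-! ## §2 The dyadic quadratic class `π² = c ≡ 3 (mod 4)`: a norm-non-increasing functional with `ℓ(1) = ℓ(π) = 1` -/

variable {K : Type} [NontriviallyNormedField K] [NormedAlgebra ℚ_[2] K] [IsUltrametricDist K] [ProperSpace K]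
variable {π : K} {c : ℚ_[2]}

omit [ProperSpace K] in
/-- **`ℓ = s + t` on `b = s·1 + t·π`** (`[K : ℚ₂] = 2`, `π² = c`, `‖c‖ = 1`, `‖1 + c‖ ≤ ¼`): a `ℚ₂`-linear functional with
`ℓ(1) = ℓ(π) = 1` and `‖ℓ(b)‖ ≤ ‖b‖` — by `‖s·1 + t·π‖ = max(‖s + t‖, ‖t‖·‖1 − π‖)` (abc-iut-E-cx-2's `DyadicDiffTwo.norm_combo`;
`(1, 1 − π)` is an orthogonal basis and `ℓ` is its first coordinate). [cite: NeukirchANT1999, Ch. II (4.8)] -/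
theorem exists_functional_one_pi (hK : finrank ℚ_[2] K = 2) (hπ : π ^ 2 = algebraMap ℚ_[2] K c) (hc : ‖c‖ = 1)
    (hc1 : ‖1 + c‖ ≤ 4⁻¹) : ∃ ℓ : K →ₗ[ℚ_[2]] ℚ_[2], ℓ 1 = 1 ∧ ℓ π = 1 ∧ ∀ b, ‖ℓ b‖ ≤ ‖b‖ := by
  obtain ⟨B, hB0, hB1⟩ := DyadicDiffTwo.exists_basis hK hπ hc hc1
  have h1 : B.repr 1 = Finsupp.single 0 1 := by rw [← hB0, B.repr_self]
  have hπr : B.repr π = Finsupp.single 1 1 := by rw [← hB1, B.repr_self]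
  refine ⟨B.coord 0 + B.coord 1, ?_, ?_, fun b => ?_⟩
  · rw [LinearMap.add_apply, Basis.coord_apply, Basis.coord_apply, h1, Finsupp.single_apply, Finsupp.single_apply,
      if_pos rfl, if_neg (by decide), add_zero]
  · rw [LinearMap.add_apply, Basis.coord_apply, Basis.coord_apply, hπr, Finsupp.single_apply, Finsupp.single_apply,
      if_neg (by decide), if_pos rfl, zero_add]
  · have hb : b = B.repr b 0 • (1 : K) + B.repr b 1 • π := by
      conv_lhs => rw [← B.sum_repr b]
      rw [Fin.sum_univ_two, hB0, hB1]
    rw [LinearMap.add_apply, Basis.coord_apply, Basis.coord_apply]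
    conv_rhs => rw [hb, DyadicDiffTwo.norm_combo hπ hc hc1]
    exact le_max_left _ _

/-! ## §3 The Gauss idempotent `½(1 ⊗ 1 − i ⊗ i)` is not in the additive span of the integral pure tensors -/

/-- **`x = ½(1 ⊗ 1 − i ⊗ i) ∉ AddSubgroup.closure {integral pure tensors}`** at `K ∋ i`, `i² = −1`, `[K : ℚ₂] = 2`: with `ℓ`
of §2 (`c = −1`, `π = i`) the functional `Φ_ℓ : a ⊗ b ↦ ℓ(b)·a` satisfies `‖Φ_ℓ(a ⊗ b)‖ ≤ ‖a‖‖b‖ ≤ 1` on every integral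
pure tensor, hence `‖Φ_ℓ‖ ≤ 1` on their additive span (ultrametric inequality), whereas
`Φ_ℓ(x) = ½(ℓ(1)·1 − ℓ(i)·i) = ½(1 − i)` has norm `2·‖1 − i‖ > 1` (`‖1 − i‖² = ½`).
[cite: Mochizuki2012, IUTchIV Prop. 1.1 p. 9] [cite: NeukirchANT1999, Ch. II (4.8)] -/
theorem gaussIdempotent_not_mem_closure_pure (hK : finrank ℚ_[2] K = 2) {i : K} (hi : i ^ 2 = -1) :
    (2 : ℚ_[2])⁻¹ • ((1 : PacketAlgebra 2 (fun _ : Fin 2 => K)) - purePacket 2 (fun _ : Fin 2 => K) ![i, i]) ∉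
      AddSubgroup.closure {t : PacketAlgebra 2 (fun _ : Fin 2 => K) |
        t ∈ normalizedPacket 2 (fun _ : Fin 2 => K) ∧ ∃ x : Fin 2 → K, t = purePacket 2 (fun _ : Fin 2 => K) x} := by
  have hπ : i ^ 2 = algebraMap ℚ_[2] K (-1) := by rw [hi, map_neg, map_one]
  have hc : ‖(-1 : ℚ_[2])‖ = 1 := by rw [norm_neg, norm_one]
  have hc1 : ‖(1 : ℚ_[2]) + -1‖ ≤ 4⁻¹ := by norm_num
  obtain ⟨ℓ, hℓ1, hℓi, hℓ⟩ := exists_functional_one_pi hK hπ hc hc1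
  obtain ⟨Φ, hΦ⟩ := exists_pairFunctional (p := 2) (K := K) ℓ
  intro hmem
  -- `‖Φ‖ ≤ 1` on the additive span of the integral pure tensors
  have hbound : ‖Φ ((2 : ℚ_[2])⁻¹ • ((1 : PacketAlgebra 2 (fun _ : Fin 2 => K)) -
      purePacket 2 (fun _ : Fin 2 => K) ![i, i]))‖ ≤ 1 := by
    refine AddSubgroup.closure_induction (p := fun t _ => ‖Φ t‖ ≤ 1) ?_ ?_ ?_ ?_ hmem
    · rintro _ ⟨ht, y, rfl⟩
      rw [hΦ, norm_smul, mul_comm]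
      exact (mul_le_mul_of_nonneg_left (hℓ (y 1)) (norm_nonneg _)).trans
        (norm_mul_norm_le_one_of_purePacket_mem ht)
    · rw [map_zero, norm_zero]; exact zero_le_one
    · intro a b _ _ ha hb
      rw [map_add]
      exact (IsUltrametricDist.norm_add_le_max _ _).trans (max_le ha hb)
    · intro a _ ha
      rw [map_neg, norm_neg]; exact ha
  -- `Φ(x) = ½(1 − i)`
  have hone : Φ 1 = 1 := by
    rw [← WildQuadratic.purePacket_pair_one, hΦ]
    simp only [Matrix.cons_val_one, Matrix.cons_val_zero, hℓ1, one_smul]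
  have hii : Φ (purePacket 2 (fun _ : Fin 2 => K) ![i, i]) = i := by
    rw [hΦ]
    simp only [Matrix.cons_val_one, Matrix.cons_val_zero, hℓi, one_smul]
  have hval : Φ ((2 : ℚ_[2])⁻¹ • ((1 : PacketAlgebra 2 (fun _ : Fin 2 => K)) -
      purePacket 2 (fun _ : Fin 2 => K) ![i, i])) = (2 : ℚ_[2])⁻¹ • (1 - i) := by
    rw [map_smul, map_sub, hone, hii]
  have hnorm : ‖(2 : ℚ_[2])⁻¹ • ((1 : K) - i)‖ = 2 * ‖1 - i‖ := by
    rw [norm_smul, norm_inv, WildDyadic.norm_two, inv_inv]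
  have hgt := WildGaussian.one_lt_two_mul_norm_one_sub_i hi
  rw [hval, hnorm] at hbound
  linarith

/-! ## §4 `p = 2`: fixed by every factorwise isometry AND not purely generated -/

/-- **At `K ∋ i`, `i² = −1`, `[K : ℚ₂] = 2`: every pair of factorwise `ℚ₂`-linear isometries maps `(R_I)^∼` ONTO itself
(abc-iut-E-cx-2's `DyadicDiffTwo`), AND some element of `(R_I)^∼` (the Gauss idempotent) lies OUTSIDE the additive span of the
integral pure tensors** — so «fixed ⟹ purely generated» (`PureTensorCriterion.mem_closure_pure_of_isometry_stable`, `p` odd)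
fails at `p = 2`. [cite: Mochizuki2012, IUTchIV Prop. 1.1 p. 9] [cite: NeukirchANT1999, Ch. II (4.8)] -/
theorem isometry_stable_and_not_closure_pure (hK : finrank ℚ_[2] K = 2) {i : K} (hi : i ^ 2 = -1) :
    (∀ f : (∀ _ : Fin 2, K ≃ₗ[ℚ_[2]] K), (∀ s x, ‖f s x‖ = ‖x‖) →
      (PiTensorProduct.congr f :
          PacketAlgebra 2 (fun _ : Fin 2 => K) ≃ₗ[ℚ_[2]] PacketAlgebra 2 (fun _ : Fin 2 => K)) ''
          (normalizedPacket 2 (fun _ : Fin 2 => K) : Set (PacketAlgebra 2 (fun _ : Fin 2 => K))) =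
        normalizedPacket 2 (fun _ : Fin 2 => K)) ∧
    ∃ w ∈ normalizedPacket 2 (fun _ : Fin 2 => K), w ∉ AddSubgroup.closure {t : PacketAlgebra 2 (fun _ : Fin 2 => K) |
        t ∈ normalizedPacket 2 (fun _ : Fin 2 => K) ∧ ∃ x : Fin 2 → K, t = purePacket 2 (fun _ : Fin 2 => K) x} :=
  ⟨fun f hf => DyadicDiffTwo.congr_image_normalizedPacket_eq_of_isometry_of_sq_eq_neg_one hK hi f hf,
    _, WildGaussian.gaussIdempotent_mem_normalizedPacket hi, gaussIdempotent_not_mem_closure_pure hK hi⟩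

/-- **The hypothesis `p ≠ 2` of `PureTensorCriterion.mem_closure_pure_of_isometry_stable` cannot be dropped**: at
`K ∋ i`, `i² = −1`, `[K : ℚ₂] = 2`, its pointwise stability hypothesis HOLDS for every factorwise isometry pair, and its
conclusion `(PG)` FAILS. [cite: Mochizuki2012, IUTchIV Prop. 1.1 p. 9] [cite: NeukirchANT1999, Ch. II (4.8)] -/
theorem not_closure_pure_of_isometry_stable_two (hK : finrank ℚ_[2] K = 2) {i : K} (hi : i ^ 2 = -1) :
    (∀ g : (∀ _ : Fin 2, K ≃ₗ[ℚ_[2]] K), (∀ s x, ‖g s x‖ = ‖x‖) →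
      ∀ z ∈ normalizedPacket 2 (fun _ : Fin 2 => K),
        (PiTensorProduct.congr g :
          PacketAlgebra 2 (fun _ : Fin 2 => K) ≃ₗ[ℚ_[2]] PacketAlgebra 2 (fun _ : Fin 2 => K)) z ∈
          normalizedPacket 2 (fun _ : Fin 2 => K)) ∧
    ¬ ∀ z ∈ normalizedPacket 2 (fun _ : Fin 2 => K), z ∈ AddSubgroup.closure {t : PacketAlgebra 2 (fun _ : Fin 2 => K) |
        t ∈ normalizedPacket 2 (fun _ : Fin 2 => K) ∧ ∃ x : Fin 2 → K, t = purePacket 2 (fun _ : Fin 2 => K) x} := by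
  obtain ⟨hstab, w, hw, hnot⟩ := isometry_stable_and_not_closure_pure hK hi
  refine ⟨fun g hg z hz => ?_, fun h => hnot (h w hw)⟩
  have hmem : (PiTensorProduct.congr g :
      PacketAlgebra 2 (fun _ : Fin 2 => K) ≃ₗ[ℚ_[2]] PacketAlgebra 2 (fun _ : Fin 2 => K)) z ∈
      (PiTensorProduct.congr g :
        PacketAlgebra 2 (fun _ : Fin 2 => K) ≃ₗ[ℚ_[2]] PacketAlgebra 2 (fun _ : Fin 2 => K)) ''
        (normalizedPacket 2 (fun _ : Fin 2 => K) : Set (PacketAlgebra 2 (fun _ : Fin 2 => K))) := mem_image_of_mem _ hz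
  rwa [hstab g hg] at hmem

end PureTensorCriterion

/-! ## §5 Non-vacuity inside `ℚ̄₂` -/

/-- **NON-VACUITY AT `ℚ₂(√−1) ⊆ ℚ̄₂`**: there is a quadratic `E ⊆ ℚ̄₂` with `√−1 ∈ E` at which every pair of factorwise
`ℚ₂`-linear isometries fixes `(R_I)^∼ ⊆ E ⊗_{ℚ₂} E` while `(R_I)^∼` is not additively generated by its integral pure tensors
(E-cx-2's `DyadicDiffTwo.exists_subfield`). [cite: Mochizuki2012, IUTchIV Prop. 1.1 p. 9] [cite: NeukirchANT1999, Ch. II (4.8)] -/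
theorem exists_gaussianDyadic_stable_not_closure_pure :
    ∃ (E : IntermediateField ℚ_[2] (PadicAlgCl 2)) (_ : FiniteDimensional ℚ_[2] E),
      finrank ℚ_[2] E = 2 ∧ (∃ i : E, i ^ 2 = -1) ∧
        (∀ f : (∀ _ : Fin 2, (E : Type) ≃ₗ[ℚ_[2]] E), (∀ s x, ‖f s x‖ = ‖x‖) →
          (PiTensorProduct.congr f :
              PacketAlgebra 2 (fun _ : Fin 2 => (E : Type)) ≃ₗ[ℚ_[2]] PacketAlgebra 2 (fun _ : Fin 2 => (E : Type))) ''
              (normalizedPacket 2 (fun _ : Fin 2 => (E : Type)) : Set (PacketAlgebra 2 (fun _ : Fin 2 => (E : Type)))) =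
            normalizedPacket 2 (fun _ : Fin 2 => (E : Type))) ∧
        ∃ w ∈ normalizedPacket 2 (fun _ : Fin 2 => (E : Type)),
          w ∉ AddSubgroup.closure {t : PacketAlgebra 2 (fun _ : Fin 2 => (E : Type)) |
            t ∈ normalizedPacket 2 (fun _ : Fin 2 => (E : Type)) ∧
              ∃ x : Fin 2 → (E : Type), t = purePacket 2 (fun _ : Fin 2 => (E : Type)) x} := by
  obtain ⟨E, π, hfd, hK, hπ⟩ := DyadicDiffTwo.exists_subfield (-1) (by rw [norm_neg, norm_one]) (by norm_num)
  have hi : π ^ 2 = -1 := by rw [hπ, map_neg, map_one]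
  haveI := hfd
  exact ⟨E, hfd, hK, ⟨π, hi⟩, PureTensorCriterion.isometry_stable_and_not_closure_pure (K := E) hK hi⟩

end Literature.IUT.LogVolume

end
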